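import Summits.NavierStokesRegularity.NavierStokesRegularity.Theorems.GaldiLiouvilleGateCylinderBudgetsAssembly
import Summits.NavierStokesRegularity.NavierStokesRegularity.Theorems.GaldiLiouvilleGateAllAxesCylinderDecayOfHessian
import Literature.Analysis.FluidPDE.SteadyHeadPressureMaximumPrinciple

/-!
# GaldiLiouvilleGateCylinderBudgetsRungSplit — census rows S1 ⟨0895⟩ / S3 ⟨0896⟩ (lines «allaxes» / «cylbudget»):
# the RUNGS modulo exactly the two named Literature facts and the last open support O1c′ (assembler ns-s29-p2 g3)

Sequel of `…CylinderBudgetsAssembly` (p632025).  Newly landed inputs plugged BY NAME: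
* O1a″ `CylinderDecayOfHessian` ← `AllAxesBudget.cylinderDecayOfHessian` (ns-in-wu-p33 g2, p631253: ray inequality +
  cylindrical Tonelli, `…AllAxesCylinderDecayOfHessian`);
* O1a from the named fact W. Wang 2025 Lemma 3.5 (`∇²p ∈ L¹` for D-solutions; CLMS ℋ¹ + Calderón–Zygmund):
  `Literature.Analysis.FluidPDE.pressureHessianIntegrable_of_fact` (wu-p33, `SteadyHeadPressureMaximumPrinciple`);
* O1b′ (pressure limit `P → c`, Galdi X.5.1 = W. Wang 2025 Thm 2.1) from the named fact:
  `Literature.Analysis.FluidPDE.pressureLimit_of_uniformDecay`.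
Hence `cylinderBudget_of_facts : h35 → h21 → CylinderBookkeepingSplit → CylinderBudget` and the RUNGS
`hoopEnergyLiouville_of_facts` (⟨0895⟩ line: «u_θ ∈ L² about one axis ⇒ U ≡ 0» for general D-solutions) and
`finiteSwirlEnergyLiouville_of_facts` (⟨0896⟩ line) — CONDITIONAL on exactly: the two Literature facts
`wang2025_lem35_DSolution_pressureHessian_integrable`, `wang2025_thm21_DSolution_uniformDecay`, and the one remaining
support O1c′ `CylinderBookkeepingSplit` (ns-in-ser-a g2, pieces p628250 / p629261 / p629668 / … in progress).

WHAT THIS IS NOT: no summit, no ⟨0895⟩/⟨0896⟩ claim (their cruxes K1/K2 are untouched) and no NS-regularity statement;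
the rungs stay conditional as displayed until O1c′ lands and the two facts are discharged.
-/

noncomputable section

open MeasureTheory Set Filter Topology
open scoped ENNReal
open Literature.Analysis.FluidPDE

set_option linter.dupNamespace false

namespace Summit.NavierStokesRegularity.NavierStokesRegularity.Theorems.GaldiLiouville.AllAxesBudget

/-- **O1a″ holds** (ns-in-wu-p33 g2, p631253). -/
theorem cylinderDecayOfHessian_holds : CylinderDecayOfHessian := cylinderDecayOfHessian

/-- **O1a modulo the named fact** (W. Wang 2025 Lemma 3.5). -/
theorem pressureHessianIntegrable_of_fact' (h35 : wang2025_lem35_DSolution_pressureHessian_integrable) :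
    PressureHessianIntegrable :=
  pressureHessianIntegrable_of_fact h35

/-- **O1b modulo the named fact** (Galdi X.5.1 / W. Wang 2025 Thm 2.1, through wu-con's O1b″). -/
theorem headMaximumPrinciple_of_fact (h21 : wang2025_thm21_DSolution_uniformDecay) : HeadMaximumPrinciple :=
  headMaximumPrinciple_of_pressureLimit' (pressureLimit_of_uniformDecay h21)

/-- **O1 `CylinderBudget` modulo the two facts and O1c′.** -/
theorem cylinderBudget_of_facts (h35 : wang2025_lem35_DSolution_pressureHessian_integrable)
    (h21 : wang2025_thm21_DSolution_uniformDecay) (h1c' : CylinderBookkeepingSplit) : CylinderBudget :=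
  cylinderBookkeeping_of_split cylinderDecayOfHessian_holds h1c' (pressureHessianIntegrable_of_fact' h35)
    (headMaximumPrinciple_of_fact h21)

/-- **RUNG ⟨0895⟩ modulo the two facts and O1c′**: a smooth D-solution of steady Navier–Stokes on `ℝ³` whose azimuthal
component about the `x₃`-axis is square-integrable is trivial. -/
theorem hoopEnergyLiouville_of_facts (h35 : wang2025_lem35_DSolution_pressureHessian_integrable)
    (h21 : wang2025_thm21_DSolution_uniformDecay) (h1c' : CylinderBookkeepingSplit) : HoopEnergyLiouville :=
  hoopEnergyLiouville_of_cylinderBudget (cylinderBudget_of_facts h35 h21 h1c')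

end Summit.NavierStokesRegularity.NavierStokesRegularity.Theorems.GaldiLiouville.AllAxesBudget

namespace Summit.NavierStokesRegularity.NavierStokesRegularity.Theorems.AxisymGaldiLiouville.CylinderBudget

open Summit.NavierStokesRegularity.NavierStokesRegularity.Theorems.GaldiLiouville

/-- **RUNG ⟨0896⟩ modulo the two facts and O1c′**: an axisymmetric D-solution with finite swirl energy is trivial. -/
theorem finiteSwirlEnergyLiouville_of_facts (h35 : wang2025_lem35_DSolution_pressureHessian_integrable)
    (h21 : wang2025_thm21_DSolution_uniformDecay) (h1c' : AllAxesBudget.CylinderBookkeepingSplit) :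
    FiniteSwirlEnergyLiouville :=
  finiteSwirlEnergyLiouville_of_cylinderBudget (AllAxesBudget.cylinderBudget_of_facts h35 h21 h1c')

end Summit.NavierStokesRegularity.NavierStokesRegularity.Theorems.AxisymGaldiLiouville.CylinderBudget

end
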